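import Literature.MathematicalPhysics.QuantumFieldTheory.ConformalBootstrap3D.PointCertificate
import Literature.MathematicalPhysics.QuantumFieldTheory.ConformalBootstrap3D.PointFunctionalChord

/-!
# The point-functional certificate as a finite table (checker specification, architecture B″)

`boxExcluded_of_pointRules` (the schema) still quantifies over real `Δ`, `E`, `s`. This file
discharges those quantifiers by FINITE TABLES, so that a certificate instance — and an external
verified checker — has to establish only a finite list of closed-form inequalities between the
certificate's own numbers:

* (O1) one number: `0 < termCornerBound w z z̄ 0 0 0 s_lo s_hi`;
* (O2)+(O3) one row of half-open cells `[t₀,t₁), …, [t_{K-1}, t_K)` for `ℓ = 0` from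
  `t₀ = ε_lo ∈ [1, 3]` (at or below the `Δ_ε`-range of the box) to `t_K = E₀`, and (O4) one row per even
  `0 < ℓ < L` from `ℓ + 1` to `E₀` (`E₀ ≤ L + 1`); per cell a head level `n_F` with
  `t_k + n_F + 1 ≥ E₀`, a rule bit (corner / chord) and ONE number `headNumber ≥ 0`
  (`headCellBound` resp. `headChordBound` on the canonical head set `headSet ℓ n_F`);
* (M) one row of boxes per `j` with `j + 1/2 < E_T`, from `≤ max(E₀, j + 1/2)` to `≥ E_T`, per box a
  rule bit and ONE number `boxNumber ≥ 0` (`termCornerBound` resp. `termChordMin`);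
* (T) the apex inequality at `E_T`;
* side conditions of the chord rule: node ratios `≥ 1/2` for the `s`-width and for the widths of
  the cells/boxes that use it.

Main theorem: `boxExcluded_of_pointTable`. Also `BoxExcluded.union` (sub-boxes in `Δ_σ`).
[cite: HogervorstRychkov2013, §3 eq. (3.6)]
-/

noncomputable section

namespace Literature.MathematicalPhysics.QuantumFieldTheory.ConformalBootstrap3D

open Finset Set

/-- Excluded boxes may be assembled from excluded pieces. [folklore] -/
theorem BoxExcluded.union {Q Q' : Set (ℝ × ℝ)} (h : BoxExcluded Q) (h' : BoxExcluded Q') :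
    BoxExcluded (Q ∪ Q') := fun D hD hmem =>
  hmem.elim (fun hq => h D hD hq) (fun hq => h' D hD hq)

/-- Excluded boxes may be assembled from finitely or infinitely many excluded pieces. [folklore] -/
theorem boxExcluded_iUnion {ι : Type*} {Q : ι → Set (ℝ × ℝ)} (h : ∀ i, BoxExcluded (Q i)) :
    BoxExcluded (⋃ i, Q i) := fun D hD hmem => by
  obtain ⟨i, hi⟩ := Set.mem_iUnion.1 hmem
  exact h i D hD hi

/-! ### Locating a point in a row of half-open cells -/

/-- A point of `[t₀, t_K)` lies in one of the cells `[t_k, t_{k+1})`, `k < K` (no monotonicity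
needed). [folklore] -/
theorem exists_cell_Ico (t : ℕ → ℝ) : ∀ K : ℕ, ∀ x ∈ Ico (t 0) (t K), ∃ k < K, x ∈ Ico (t k) (t (k + 1)) := by
  intro K
  induction K with
  | zero => intro x hx; exact absurd hx.2 (not_lt.2 hx.1)
  | succ K ih =>
    intro x hx
    by_cases hK : x < t K
    · obtain ⟨k, hk, hxk⟩ := ih x ⟨hx.1, hK⟩
      exact ⟨k, by omega, hxk⟩
    · exact ⟨K, by omega, ⟨not_lt.1 hK, hx.2⟩⟩

/-! ### The canonical head set and the cell numbers -/

/-- Canonical head set of a cell with head level `n_F`: levels `n ≤ n_F`, spins `j ≤ ℓ + n_F`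
(indices outside the descendant range contribute `0`). [folklore] -/
def headSet (ℓ nF : ℕ) : Finset (ℕ × ℕ) :=
  Finset.range (nF + 1) ×ˢ Finset.range (ℓ + nF + 1)

/-- Off the canonical head set every descendant index has level `> n_F`, hence `a + n ≥ E₀` once
`a + n_F + 1 ≥ E₀`. [folklore] -/
theorem headSet_off {ℓ nF : ℕ} {a E₀ : ℝ} (h : E₀ ≤ a + ((nF : ℝ) + 1)) :
    ∀ q : ℕ × ℕ, q ∉ headSet ℓ nF → InDescendantRange ℓ q.1 q.2 → E₀ ≤ a + q.1 := by
  intro q hq hr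
  simp only [headSet, Finset.mem_product, Finset.mem_range, not_and_or, not_lt] at hq
  have hj : q.2 ≤ ℓ + q.1 := hr.2.1
  have hn : nF + 1 ≤ q.1 := by
    rcases hq with h1 | h2
    · exact h1
    · omega
  have : (nF : ℝ) + 1 ≤ q.1 := by exact_mod_cast hn
  linarith

/-- The number of a head cell: corner (`useChord = false`) or chord (`useChord = true`) head-cell
bound on the canonical head set. [cite: HogervorstRychkov2013, §3 eq. (3.9)] -/
def headNumber {N : ℕ} (w z zb : Fin N → ℝ) (ℓ : ℕ) (a b slo shi : ℝ) (nF : ℕ)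
    (useChord : Bool) : ℝ :=
  if useChord then headChordBound w z zb ℓ a b slo shi (headSet ℓ nF)
  else headCellBound w z zb ℓ a b slo shi (headSet ℓ nF)

/-- The number of an (M) box: corner (`termCornerBound`) or chord (`termChordMin`).
[cite: HogervorstRychkov2013, §3 eq. (3.6)] -/
def boxNumber {N : ℕ} (w z zb : Fin N → ℝ) (j : ℕ) (E₁ E₂ slo shi : ℝ) (useChord : Bool) : ℝ :=
  if useChord then termChordMin w z zb j slo shi E₁ E₂ else termCornerBound w z zb j E₁ E₂ slo shi

/-- **One head cell from its number.** [cite: HogervorstRychkov2013, §3 eq. (3.9)] -/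
theorem cell_of_headNumber {N : ℕ} (w z zb : Fin N → ℝ)
    (hz : ∀ k, z k ∈ Ioo (0 : ℝ) 1) (hzb : ∀ k, zb k ∈ Ioo (0 : ℝ) 1) (hord : ∀ k, zb k ≤ z k)
    (apex : Fin N) (hapex : 0 ≤ w apex) (qd qr : Fin N → ℝ) (hqd : ∀ k, 0 < qd k ∧ qd k ≤ 1)
    (hqr : ∀ k, 0 < qr k ∧ qr k ≤ 1)
    (hdomd : ∀ k, z k * zb k ≤ qd k ^ 2 * (z apex * zb apex) ∧ z k ≤ qd k * z apex)
    (hdomr : ∀ k, (1 - z k) * (1 - zb k) ≤ qr k ^ 2 * (z apex * zb apex) ∧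
      1 - zb k ≤ qr k * z apex)
    {Q : Set (ℝ × ℝ)} {slo shi E₀ ET : ℝ} (hQ : ∀ p ∈ Q, slo ≤ p.1 ∧ p.1 ≤ shi)
    (hM : ∀ (j : ℕ) (E : ℝ), E₀ ≤ E → E < ET → (j : ℝ) + 1 / 2 ≤ E → ∀ p ∈ Q,
      0 ≤ pointFunctional w z zb (crossF p.1 (-1) (zMono E j)))
    (hB : ∑ k ∈ univ.erase apex, |w k| * ((1 - z k) * (1 - zb k)) ^ slo * qd k ^ ET
          + ∑ k, |w k| * (z k * zb k) ^ slo * qr k ^ ET ≤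
          w apex * ((1 - z apex) * (1 - zb apex)) ^ shi)
    (hr : ∀ k, 1 / 2 ≤ ((1 - z k) * (1 - zb k)) ^ (shi - slo) ∧ 1 / 2 ≤ (z k * zb k) ^ (shi - slo))
    {ℓ : ℕ} {a b : ℝ} (ha : (ℓ : ℝ) + 1 ≤ a) (nF : ℕ) (hnF : E₀ ≤ a + ((nF : ℝ) + 1))
    (useChord : Bool)
    (hρ : useChord = true → ∀ k, 1 / 2 ≤ (z k * zb k) ^ ((b - a) / 2) ∧
      1 / 2 ≤ ((1 - z k) * (1 - zb k)) ^ ((b - a) / 2))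
    (hnum : 0 ≤ headNumber w z zb ℓ a b slo shi nF useChord) :
    ∀ p ∈ Q, ∀ Δ ∈ Ico a b, BlockPositive (pointFunctional w z zb) p.1 Δ ℓ := by
  cases useChord with
  | true =>
    simp only [headNumber, if_true] at hnum
    exact headChord_pointFunctional_of_pointRules w z zb hz hzb hord apex hapex qd qr hqd hqr hdomd
      hdomr hQ hM hB ha (headSet ℓ nF) (headSet_off hnF) hr (hρ rfl) hnum
  | false =>
    simp only [headNumber] at hnum
    exact headCell_pointFunctional_of_pointRules w z zb hz hzb hord apex hapex qd qr hqd hqr hdomd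
      hdomr hQ hM hB ha (headSet ℓ nF) (headSet_off hnF) (by simpa using hnum)

/-- **(M) from a table of boxes.** For every `j` with `j + 1/2 < E_T` a row of boxes
`[e_{j,0}, e_{j,1}], …` with `e_{j,0} ≤ max(E₀, j + 1/2)`, `E_T ≤ e_{j,M_j}`, and per box a number
`boxNumber ≥ 0` (chord boxes with node ratios `≥ 1/2` for their width) give rule (M) on
`[E₀, E_T)`. [cite: HogervorstRychkov2013, §3 eq. (3.6)] -/
theorem ruleM_of_boxTable {N : ℕ} (w z zb : Fin N → ℝ)
    (hz : ∀ k, z k ∈ Ioo (0 : ℝ) 1) (hzb : ∀ k, zb k ∈ Ioo (0 : ℝ) 1)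
    {Q : Set (ℝ × ℝ)} {slo shi E₀ ET : ℝ} (hQ : ∀ p ∈ Q, slo ≤ p.1 ∧ p.1 ≤ shi)
    (hr : ∀ k, 1 / 2 ≤ ((1 - z k) * (1 - zb k)) ^ (shi - slo) ∧ 1 / 2 ≤ (z k * zb k) ^ (shi - slo))
    (e : ℕ → ℕ → ℝ) (M : ℕ → ℕ) (bc : ℕ → ℕ → Bool)
    (he : ∀ j : ℕ, (j : ℝ) + 1 / 2 < ET → e j 0 ≤ max E₀ ((j : ℝ) + 1 / 2) ∧ ET ≤ e j (M j))
    (hρ : ∀ j m, m < M j → bc j m = true → ∀ k, 1 / 2 ≤ (z k * zb k) ^ ((e j (m + 1) - e j m) / 2) ∧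
      1 / 2 ≤ ((1 - z k) * (1 - zb k)) ^ ((e j (m + 1) - e j m) / 2))
    (hbox : ∀ j : ℕ, (j : ℝ) + 1 / 2 < ET → ∀ m < M j,
      0 ≤ boxNumber w z zb j (e j m) (e j (m + 1)) slo shi (bc j m)) :
    ∀ (j : ℕ) (E : ℝ), E₀ ≤ E → E < ET → (j : ℝ) + 1 / 2 ≤ E → ∀ p ∈ Q,
      0 ≤ pointFunctional w z zb (crossF p.1 (-1) (zMono E j)) := by
  intro j E hE0 hET hjE p hp
  have hjT : (j : ℝ) + 1 / 2 < ET := lt_of_le_of_lt hjE hET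
  obtain ⟨he0, heM⟩ := he j hjT
  have hE : E ∈ Ico (e j 0) (e j (M j)) := ⟨he0.trans (max_le hE0 hjE), lt_of_lt_of_le hET heM⟩
  obtain ⟨m, hm, hEm⟩ := exists_cell_Ico (e j) (M j) E hE
  have hnum := hbox j hjT m hm
  have hs : p.1 ∈ Icc slo shi := ⟨(hQ p hp).1, (hQ p hp).2⟩
  have hEc : E ∈ Icc (e j m) (e j (m + 1)) := ⟨hEm.1, hEm.2.le⟩
  cases hb : bc j m with
  | true =>
    rw [hb] at hnum; simp only [boxNumber, if_true] at hnum
    exact termwise_nonneg_of_chordMin w z zb hz hzb j hr (hρ j m hm hb) hnum E hEc p.1 hs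
  | false =>
    rw [hb] at hnum; simp only [boxNumber] at hnum
    exact termwise_nonneg_of_cornerBound w z zb hz hzb j (by simpa using hnum) E hEc p.1 hs

/-- **The point-functional certificate as a finite table.** Nodes in the open square with
`z̄ ≤ z`, an apex `a` with `w_a ≥ 0` and domination ratios `qd, qr ∈ (0,1]`; the box
`Q ⊆ [s_lo, s_hi] × [ε_lo, E₀)` with `ε_lo ≤ 3`; `E₀ ≤ L + 1`; every cell starts at `≥ ℓ + 1`
(so `ε_lo ≥ 1`); global chord side condition for
the `s`-width. DATA: head rows `t ℓ k` (`k ≤ K ℓ`) with head levels `nF ℓ k` and rule bits `hc ℓ k`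
for `ℓ = 0` (from `ε_lo` to `E₀`) and for even `0 < ℓ < L` (from `ℓ + 1` to `E₀`); box rows
`e j m` (`m ≤ M j`) with rule bits `bc j m` for `j + 1/2 < E_T`. CHECKS: (O1) the identity corner
number `> 0`; every head number `≥ 0`; every box number `≥ 0`; (T) the apex inequality at `E_T`;
the chord side conditions of the cells/boxes using the chord rule. CONCLUSION: `BoxExcluded Q`.
[cite: HogervorstRychkov2013, §3 eq. (3.6)] -/
theorem boxExcluded_of_pointTable {N : ℕ} {w z zb : Fin N → ℝ}
    (hz : ∀ k, z k ∈ Ioo (0 : ℝ) 1) (hzb : ∀ k, zb k ∈ Ioo (0 : ℝ) 1) (hord : ∀ k, zb k ≤ z k)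
    (apex : Fin N) (hapex : 0 ≤ w apex) (qd qr : Fin N → ℝ) (hqd : ∀ k, 0 < qd k ∧ qd k ≤ 1)
    (hqr : ∀ k, 0 < qr k ∧ qr k ≤ 1)
    (hdomd : ∀ k, z k * zb k ≤ qd k ^ 2 * (z apex * zb apex) ∧ z k ≤ qd k * z apex)
    (hdomr : ∀ k, (1 - z k) * (1 - zb k) ≤ qr k ^ 2 * (z apex * zb apex) ∧
      1 - zb k ≤ qr k * z apex)
    {Q : Set (ℝ × ℝ)} {slo shi εlo E₀ ET : ℝ}
    (hQ : ∀ p ∈ Q, (slo ≤ p.1 ∧ p.1 ≤ shi) ∧ (εlo ≤ p.2 ∧ p.2 < E₀))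
    (hε3 : εlo ≤ 3) (L : ℕ) (hL : E₀ ≤ (L : ℝ) + 1)
    (hr : ∀ k, 1 / 2 ≤ ((1 - z k) * (1 - zb k)) ^ (shi - slo) ∧ 1 / 2 ≤ (z k * zb k) ^ (shi - slo))
    -- (O1)
    (hI : 0 < termCornerBound w z zb 0 0 0 slo shi)
    -- head rows
    (t : ℕ → ℕ → ℝ) (K : ℕ → ℕ) (nF : ℕ → ℕ → ℕ) (hc : ℕ → ℕ → Bool)
    (ht0 : t 0 0 = εlo ∧ t 0 (K 0) = E₀)
    (htℓ : ∀ ℓ, Even ℓ → ℓ ≠ 0 → ℓ < L → t ℓ 0 = (ℓ : ℝ) + 1 ∧ t ℓ (K ℓ) = E₀)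
    (hlow : ∀ ℓ k, k < K ℓ → (ℓ : ℝ) + 1 ≤ t ℓ k)
    (hnF : ∀ ℓ k, k < K ℓ → E₀ ≤ t ℓ k + ((nF ℓ k : ℝ) + 1))
    (hρ : ∀ ℓ k, k < K ℓ → hc ℓ k = true → ∀ i, 1 / 2 ≤ (z i * zb i) ^ ((t ℓ (k + 1) - t ℓ k) / 2) ∧
      1 / 2 ≤ ((1 - z i) * (1 - zb i)) ^ ((t ℓ (k + 1) - t ℓ k) / 2))
    (hhead : ∀ ℓ, (ℓ = 0 ∨ (Even ℓ ∧ ℓ < L)) → ∀ k < K ℓ,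
      0 ≤ headNumber w z zb ℓ (t ℓ k) (t ℓ (k + 1)) slo shi (nF ℓ k) (hc ℓ k))
    -- (M) box rows
    (e : ℕ → ℕ → ℝ) (M : ℕ → ℕ) (bc : ℕ → ℕ → Bool)
    (he : ∀ j : ℕ, (j : ℝ) + 1 / 2 < ET → e j 0 ≤ max E₀ ((j : ℝ) + 1 / 2) ∧ ET ≤ e j (M j))
    (hρM : ∀ j m, m < M j → bc j m = true → ∀ k, 1 / 2 ≤ (z k * zb k) ^ ((e j (m + 1) - e j m) / 2) ∧
      1 / 2 ≤ ((1 - z k) * (1 - zb k)) ^ ((e j (m + 1) - e j m) / 2))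
    (hbox : ∀ j : ℕ, (j : ℝ) + 1 / 2 < ET → ∀ m < M j,
      0 ≤ boxNumber w z zb j (e j m) (e j (m + 1)) slo shi (bc j m))
    -- (T)
    (hB : ∑ k ∈ univ.erase apex, |w k| * ((1 - z k) * (1 - zb k)) ^ slo * qd k ^ ET
          + ∑ k, |w k| * (z k * zb k) ^ slo * qr k ^ ET ≤
          w apex * ((1 - z apex) * (1 - zb apex)) ^ shi) :
    BoxExcluded Q := by
  have hQ1 : ∀ p ∈ Q, slo ≤ p.1 ∧ p.1 ≤ shi := fun p hp => (hQ p hp).1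
  have hM := ruleM_of_boxTable w z zb hz hzb hQ1 hr e M bc he hρM hbox
  -- every cell of every row
  have hcell : ∀ ℓ, (ℓ = 0 ∨ (Even ℓ ∧ ℓ < L)) → ∀ k < K ℓ, ∀ p ∈ Q,
      ∀ Δ ∈ Ico (t ℓ k) (t ℓ (k + 1)), BlockPositive (pointFunctional w z zb) p.1 Δ ℓ :=
    fun ℓ hℓ k hk => cell_of_headNumber w z zb hz hzb hord apex hapex qd qr hqd hqr hdomd hdomr hQ1
      hM hB hr (hlow ℓ k hk) (nF ℓ k) (hnF ℓ k hk) (hc ℓ k) (hρ ℓ k hk) (hhead ℓ hℓ k hk)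
  refine boxExcluded_of_pointRules hz hzb hord apex hapex qd qr hqd hqr hdomd hdomr hQ1 hI ?_ ?_ ?_
    hM hB
  · -- (O2)
    exact epsilon_nonneg_of_cells (t 0) (K 0)
      (fun p hp => ⟨ht0.1 ▸ (hQ p hp).2.1, ht0.2 ▸ (hQ p hp).2.2⟩) (hcell 0 (Or.inl rfl))
  · -- (O3)
    exact scalar_nonneg_of_cells (t 0) (K 0) (ht0.1 ▸ hε3) ht0.2 (hcell 0 (Or.inl rfl))
  · -- (O4)
    exact spinning_nonneg_of_cells L hL t K (fun ℓ hev hℓ hℓL => (htℓ ℓ hev hℓ hℓL).1.le)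
      (fun ℓ hev hℓ hℓL => (htℓ ℓ hev hℓ hℓL).2)
      (fun ℓ hev hℓ hℓL => hcell ℓ (Or.inr ⟨hev, hℓL⟩))

end Literature.MathematicalPhysics.QuantumFieldTheory.ConformalBootstrap3D
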